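import Literature.NumberTheory.Rogawski1990.ArchWallOrbitMeasureTransportCircleDiagonal  -- ★ p842112 (this seat): `wallFactor_eq_nnreal_smul_map_descConj_quotientMeasure`, `isFiniteMeasureOnCompacts_and_sigmaFinite_map_descConj_quotientMeasure_wall`
import Literature.NumberTheory.Rogawski1990.ArchWallOrbitMeasureProduct                  -- ★ p842078 (R1-h-c) F0P3-p03: `integral_comp_archPiEquivCM_symm_pi_smul_map_descConj_eq_smul_classOrbitalIntegral`; brings ★ (R1-c) p841332
import Literature.NumberTheory.Rogawski1990.ArchLimitFormulaNoncompactWallConstUnique      -- ★ p841778: `isOpenPosMeasure_quotientMeasure` (σ-finiteness of the Weil quotient via local finiteness)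
import HarnessLib

/-!
# THE END-STATE TERM OF THE «METHOD OF §8.2» IS A MULTIPLE OF A CLASS ORBITAL INTEGRAL: `∫ Θ ↑↑(e⁻¹ o) d(⊗_v Wm_v(ρ_v)) = (∏_v λ_v(ρ_v)) · Φ(⟦t(z⁰∘ρ)⟧, Θ∘coe; m)`
# ((R1-h) per-`ρ` reading = ★ p842112 per place + ★ p842078; Rogawski 1990 §8.2 pp. 122–124, §14.5 p. 238)

Topic `NumberTheory/Rogawski1990`; namespace `Literature.NumberTheory.Rogawski1990`.  THEOREMS ONLY (no `def`, no instance, no notation, no axiom, no named fact, no `sorry`).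
Cell `pub/hodgecm-mathlib`, ENGINE T1 (crux H413 = `stmt-HodgeConjecture-24833`); floor-2 road «(J-nc) in-house», brick (P1) of (R1-h-d) (LEAD F0P3a-plan (g9) WORD T8-119∕T8-120;
F0P3-p03 (g9) «=» 07:05:30Z∕07:08:40Z); author F0P3a-p07 (g8), 2026-09-01.

WHAT.  For ONE relabelling family `ρ : W → S₃`, the summand of ★ p841776 ∕ (D0-3) `wallCoef_sum_prod_mul_eq_of_regular_eq_of_clause` integrates the global test function `Θ`
against the product over the complex places of the WALL FACTORS `Wm_v(ρ_v)` (`if cw then ν_v.map conj_{diag(z⁰_v∘ρ_v)} else` the transported singular quotient orbit measure).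
★ p842112 `wallFactor_eq_nnreal_smul_map_descConj_quotientMeasure` rewrites each factor as `λ_v(ρ_v) • ((ν_v∕ρZ_v(ρ_v)).map orbit_{diag(z⁰_v∘ρ_v)})` with
`λ_v(σ) = (cw ? (ρZ_v σ)(Z) : 1) ∈ ℝ≥0` for centraliser measures `ρZ_v σ` on `Z(diag(z⁰_v∘σ)) ≤ G_v(α)` that are the transported reference measures `(e_{σ⁻¹}|_Z)_* νH_v(σ⁻¹)` at the
noncompact walls (`hρZ`), and ★ p842078 reads the product of such factors as `(∏_v λ_v) • Φ(⟦t(z⁰∘ρ)⟧, f; m)` for a family `m` in Weil form at `t(z⁰∘ρ)` (`hq`, with ★ (R1-c)'s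
`ρP ∕ hρP ∕ ρ′ ∕ hρ′` telescope).  This file composes the two:
**`integral_pi_wallFactor_eq_prod_smul_classOrbitalIntegral`** — the per-`ρ` END-STATE READING, hypotheses in the conjunction style of ★ p841776 (place-indexed families never as
instance binders; statement-level `haveI`).
HONEST LABEL: HC_CM is proved only modulo the 7 printed citations until rung 0 closes; this file is measure book-keeping and pays nothing by itself.

## References
* [Rogawski1990] J. D. Rogawski, *Automorphic Representations of Unitary Groups in Three Variables*, Ann. of Math. Stud. 123 (1990), §8.2 pp. 122–124, §14.5 p. 238, §1.7 p. 6.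
* [Folland1995] G. B. Folland, *A Course in Abstract Harmonic Analysis* (1995), §2.6 (2.52).
* [DeitmarEchterhoff2014] A. Deitmar, S. Echterhoff, *Principles of Harmonic Analysis*, 2nd ed. (2014), Thm. 1.5.3.
-/

set_option autoImplicit false

noncomputable section

open MeasureTheory Measure Filter Topology NumberField NumberField.InfinitePlace NumberField.mixedEmbedding Equiv Function Set
open Literature.MeasureTheory.Group Literature.NumberTheory.Automorphic Literature.NumberTheory.Automorphic.UnitaryGroup
open Literature.LinearAlgebra.Matrix
open scoped Matrix MatrixGroups Matrix.Norms.Operator ContDiff NNReal ENNReal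

namespace Literature.NumberTheory.Rogawski1990

variable (L : Type) [Field L] [NumberField L] [IsCMField L] (α : Fin 3 → L)
  [MeasurableSpace (GL (Fin 3) ℂ)] [BorelSpace (GL (Fin 3) ℂ)]
  [MeasurableSpace (arch (↥(maximalRealSubfield L)) L (IsCMField.complexConj L) 3 (Matrix.diagonal α))] [BorelSpace (arch (↥(maximalRealSubfield L)) L (IsCMField.complexConj L) 3 (Matrix.diagonal α))]
  [∀ γ' : arch (↥(maximalRealSubfield L)) L (IsCMField.complexConj L) 3 (Matrix.diagonal α),
    MeasurableSpace (arch (↥(maximalRealSubfield L)) L (IsCMField.complexConj L) 3 (Matrix.diagonal α) ⧸ Subgroup.centralizer ({γ'} : Set _))]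
  [∀ γ' : arch (↥(maximalRealSubfield L)) L (IsCMField.complexConj L) 3 (Matrix.diagonal α),
    BorelSpace (arch (↥(maximalRealSubfield L)) L (IsCMField.complexConj L) 3 (Matrix.diagonal α) ⧸ Subgroup.centralizer ({γ'} : Set _))]
  [∀ (v : {w : InfinitePlace L // IsComplex w}) (g : archLocal L 3 (Matrix.diagonal α) v),
    MeasurableSpace (archLocal L 3 (Matrix.diagonal α) v ⧸ Subgroup.centralizer ({g} : Set (archLocal L 3 (Matrix.diagonal α) v)))]
  [∀ (v : {w : InfinitePlace L // IsComplex w}) (g : archLocal L 3 (Matrix.diagonal α) v),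
    BorelSpace (archLocal L 3 (Matrix.diagonal α) v ⧸ Subgroup.centralizer ({g} : Set (archLocal L 3 (Matrix.diagonal α) v)))]

open scoped Classical in
/-- **(R1-h) THE PER-`ρ` END-STATE READING.**  For a relabelling family `ρ : W → S₃` at the wall point `z⁰` (`z⁰_v 0 = z⁰_v 2 ≠ z⁰_v 1`), with the side-`α` wall data of ★ p841776
(`νw, z₁, νH, ντ` + `hντ`), centraliser measures `ρZ_v σ` on `Z(diag(z⁰_v∘σ)) ≤ G_v(α)` transported from the reference measures at the noncompact walls (`hρZ`), and a family `m` on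
`G′_∞` in Weil form at `t(z⁰∘ρ)` for the (V7) measure `e⁻¹_*(⊗ν_v)` and the transported product `ρ′` of the `ρZ_v(ρ_v)` (★ (R1-c)'s telescope `ρP, hρP, ρ′, hρ′, hq`):
`∫ Θ ↑↑(e⁻¹ o) d(⊗_v Wm_v(ρ_v)) = (∏_v λ_v(ρ_v)) • Φ(⟦t(z⁰∘ρ)⟧, Θ∘coe; m)`, `λ_v(σ) = (cw_v(σ) ? (ρZ_v σ)(Z).toNNReal : 1)`.
[cite: Rogawski1990, §8.2 pp. 122–124; §14.5 p. 238; §1.7 p. 6] [cite: Folland1995, §2.6 (2.52)] [cite: DeitmarEchterhoff2014, Thm. 1.5.3] -/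
theorem integral_pi_wallFactor_eq_prod_smul_classOrbitalIntegral
    (hα : ∀ i, α i ≠ 0) (hherm : ∀ i, (IsCMField.complexConj L (α i) : L) = α i)
    (z0 : {w : InfinitePlace L // IsComplex w} → Fin 3 → Circle) (hwall : ∀ v, z0 v 0 = z0 v 2 ∧ z0 v 0 ≠ z0 v 1)
    (νw : ∀ v : {w : InfinitePlace L // IsComplex w}, Measure (archLocal L 3 (Matrix.diagonal α) v)) (hνw : ∀ v, (νw v).IsHaarMeasure ∧ (νw v).IsMulRightInvariant)
    (z₁ : {w : InfinitePlace L // IsComplex w} → Fin 3 → Circle) (h02 : ∀ v, z₁ v 0 = z₁ v 2) (h01 : ∀ v, z₁ v 0 ≠ z₁ v 1)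
    [∀ (v : {w : InfinitePlace L // IsComplex w}) (τ : Perm (Fin 3)), MeasurableSpace (archLocal L 3 (Matrix.diagonal (α ∘ ⇑τ)) v ⧸ Subgroup.centralizer
      ({(⟨circleDiagonal 3 (z₁ v), circleDiagonal_mem_archLocal_diagonal L 3 (α ∘ ⇑τ) v (z₁ v)⟩ : archLocal L 3 (Matrix.diagonal (α ∘ ⇑τ)) v)} :
        Set (archLocal L 3 (Matrix.diagonal (α ∘ ⇑τ)) v)))]
    [∀ (v : {w : InfinitePlace L // IsComplex w}) (τ : Perm (Fin 3)), BorelSpace (archLocal L 3 (Matrix.diagonal (α ∘ ⇑τ)) v ⧸ Subgroup.centralizer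
      ({(⟨circleDiagonal 3 (z₁ v), circleDiagonal_mem_archLocal_diagonal L 3 (α ∘ ⇑τ) v (z₁ v)⟩ : archLocal L 3 (Matrix.diagonal (α ∘ ⇑τ)) v)} :
        Set (archLocal L 3 (Matrix.diagonal (α ∘ ⇑τ)) v)))]
    (νH : ∀ (v : {w : InfinitePlace L // IsComplex w}) (τ : Perm (Fin 3)), Measure (Subgroup.centralizer
      ({(⟨circleDiagonal 3 (z₁ v), circleDiagonal_mem_archLocal_diagonal L 3 (α ∘ ⇑τ) v (z₁ v)⟩ : archLocal L 3 (Matrix.diagonal (α ∘ ⇑τ)) v)} :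
        Set (archLocal L 3 (Matrix.diagonal (α ∘ ⇑τ)) v))))
    (hνH : ∀ v τ, (νH v τ).IsHaarMeasure ∧ (νH v τ).IsInvInvariant)
    (ντ : ∀ (v : {w : InfinitePlace L // IsComplex w}) (τ : Perm (Fin 3)), Measure (archLocal L 3 (Matrix.diagonal (α ∘ ⇑τ)) v))
    (hντi : ∀ v τ, (ντ v τ).IsHaarMeasure ∧ (ντ v τ).IsMulRightInvariant)
    (hντ : ντ = fun v τ => (νw v).map (ContinuousMulEquiv.restrictSubgroup (GLn.conjEquiv (Matrix.GeneralLinearGroup.mkOfDetNeZero _ (det_monomial_one_ne_zero 3 τ)))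
              (archLocal L 3 (Matrix.diagonal (α ∘ ⇑τ)) v) (archLocal L 3 (Matrix.diagonal α) v)
              (mem_archLocal_comp_perm_iff_conj_mem L 3 α v τ)).symm)
    -- centraliser measures on `G_v(α)` at the relabelled wall points, transported from the reference measures at the NONCOMPACT walls
    (ρZ : ∀ (v : {w : InfinitePlace L // IsComplex w}) (σ : Perm (Fin 3)), Measure (Subgroup.centralizer
      ({(⟨circleDiagonal 3 (z0 v ∘ ⇑σ), circleDiagonal_mem_archLocal_diagonal L 3 α v (z0 v ∘ ⇑σ)⟩ : archLocal L 3 (Matrix.diagonal α) v)} : Set (archLocal L 3 (Matrix.diagonal α) v))))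
    (hρZi : ∀ v σ, (ρZ v σ).IsHaarMeasure ∧ (ρZ v σ).IsInvInvariant)
    (hρZ : ∀ (v : {w : InfinitePlace L // IsComplex w}) (σ : Perm (Fin 3)), ¬ 0 < (v.1.embedding (α (σ⁻¹ 0))).re * (v.1.embedding (α (σ⁻¹ 2))).re →
      ρZ v σ = (νH v σ⁻¹).map (subgroupCongrHomeomorph (ContinuousMulEquiv.restrictSubgroup (GLn.conjEquiv (Matrix.GeneralLinearGroup.mkOfDetNeZero _ (det_monomial_one_ne_zero 3 σ⁻¹)))
        (archLocal L 3 (Matrix.diagonal (α ∘ ⇑σ⁻¹)) v) (archLocal L 3 (Matrix.diagonal α) v) (mem_archLocal_comp_perm_iff_conj_mem L 3 α v σ⁻¹)).toMulEquiv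
        (Subgroup.centralizer ({(⟨circleDiagonal 3 (z₁ v), circleDiagonal_mem_archLocal_diagonal L 3 (α ∘ ⇑σ⁻¹) v (z₁ v)⟩ : archLocal L 3 (Matrix.diagonal (α ∘ ⇑σ⁻¹)) v)} : Set (archLocal L 3 (Matrix.diagonal (α ∘ ⇑σ⁻¹)) v)))
        (Subgroup.centralizer ({(⟨circleDiagonal 3 (z0 v ∘ ⇑σ), circleDiagonal_mem_archLocal_diagonal L 3 α v (z0 v ∘ ⇑σ)⟩ : archLocal L 3 (Matrix.diagonal α) v)} : Set (archLocal L 3 (Matrix.diagonal α) v)))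
        (relabel_inv_mem_centralizer_circleDiagonal_comp_iff L α v σ (h02 v) (h01 v) (hwall v).1 (hwall v).2)
        (ContinuousMulEquiv.restrictSubgroup (GLn.conjEquiv (Matrix.GeneralLinearGroup.mkOfDetNeZero _ (det_monomial_one_ne_zero 3 σ⁻¹)))
          (archLocal L 3 (Matrix.diagonal (α ∘ ⇑σ⁻¹)) v) (archLocal L 3 (Matrix.diagonal α) v) (mem_archLocal_comp_perm_iff_conj_mem L 3 α v σ⁻¹)).continuous
        (ContinuousMulEquiv.restrictSubgroup (GLn.conjEquiv (Matrix.GeneralLinearGroup.mkOfDetNeZero _ (det_monomial_one_ne_zero 3 σ⁻¹)))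
          (archLocal L 3 (Matrix.diagonal (α ∘ ⇑σ⁻¹)) v) (archLocal L 3 (Matrix.diagonal α) v) (mem_archLocal_comp_perm_iff_conj_mem L 3 α v σ⁻¹)).symm.continuous))
    (Θ : Matrix (Fin 3) (Fin 3) (mixedSpace L) → ℂ) (hΘ : Continuous Θ)
    -- the relabelling family and ★ (R1-c)'s telescope at the point `t(z⁰ ∘ ρ)`
    (ρ : {w : InfinitePlace L // IsComplex w} → Perm (Fin 3))
    [MeasurableSpace ((∀ w : {w : InfinitePlace L // IsComplex w}, archLocal L 3 (Matrix.diagonal α) w) ⧸ Subgroup.pi Set.univ (fun w =>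
      Subgroup.centralizer ({(⟨circleDiagonal 3 (z0 w ∘ ⇑(ρ w)), circleDiagonal_mem_archLocal_diagonal L 3 α w (z0 w ∘ ⇑(ρ w))⟩ : archLocal L 3 (Matrix.diagonal α) w)} : Set _)))]
    [BorelSpace ((∀ w : {w : InfinitePlace L // IsComplex w}, archLocal L 3 (Matrix.diagonal α) w) ⧸ Subgroup.pi Set.univ (fun w =>
      Subgroup.centralizer ({(⟨circleDiagonal 3 (z0 w ∘ ⇑(ρ w)), circleDiagonal_mem_archLocal_diagonal L 3 α w (z0 w ∘ ⇑(ρ w))⟩ : archLocal L 3 (Matrix.diagonal α) w)} : Set _)))]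
    (ρP : Measure (Subgroup.pi Set.univ (fun w : {w : InfinitePlace L // IsComplex w} => Subgroup.centralizer
      ({(⟨circleDiagonal 3 (z0 w ∘ ⇑(ρ w)), circleDiagonal_mem_archLocal_diagonal L 3 α w (z0 w ∘ ⇑(ρ w))⟩ : archLocal L 3 (Matrix.diagonal α) w)} : Set _))))
    [ρP.IsHaarMeasure] [ρP.IsInvInvariant]
    (hρP : Measure.map (subgroupPiCoords fun w : {w : InfinitePlace L // IsComplex w} => Subgroup.centralizer
      ({(⟨circleDiagonal 3 (z0 w ∘ ⇑(ρ w)), circleDiagonal_mem_archLocal_diagonal L 3 α w (z0 w ∘ ⇑(ρ w))⟩ : archLocal L 3 (Matrix.diagonal α) w)} : Set _)) ρP =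
        Measure.pi fun w => ρZ w (ρ w))
    [((Measure.pi νw).map (archPiEquivCM 3 L (Matrix.diagonal α)).symm).IsHaarMeasure]
    [((Measure.pi νw).map (archPiEquivCM 3 L (Matrix.diagonal α)).symm).IsMulRightInvariant]
    (m : OrbitalMeasureFamily (arch (↥(maximalRealSubfield L)) L (IsCMField.complexConj L) 3 (Matrix.diagonal α)))
    [SMulInvariantMeasure (arch (↥(maximalRealSubfield L)) L (IsCMField.complexConj L) 3 (Matrix.diagonal α))
      (arch (↥(maximalRealSubfield L)) L (IsCMField.complexConj L) 3 (Matrix.diagonal α) ⧸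
        Subgroup.centralizer ({(Quotient.out (ConjClasses.mk (archDiagTorus L 3 α fun w => z0 w ∘ ⇑(ρ w))) : arch (↥(maximalRealSubfield L)) L (IsCMField.complexConj L) 3 (Matrix.diagonal α))} : Set _))
      (m (ConjClasses.mk (archDiagTorus L 3 α fun w => z0 w ∘ ⇑(ρ w))))]
    (ρ' : Measure (Subgroup.centralizer ({archDiagTorus L 3 α fun w => z0 w ∘ ⇑(ρ w)} : Set (arch (↥(maximalRealSubfield L)) L (IsCMField.complexConj L) 3 (Matrix.diagonal α)))))
    [ρ'.IsHaarMeasure] [ρ'.IsInvInvariant]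
    (hρ' : ρ' = ρP.map (subgroupCongrHomeomorph (archPiEquivCM 3 L (Matrix.diagonal α)).symm.toMulEquiv
      (Subgroup.pi Set.univ (fun w : {w : InfinitePlace L // IsComplex w} => Subgroup.centralizer
        ({(⟨circleDiagonal 3 (z0 w ∘ ⇑(ρ w)), circleDiagonal_mem_archLocal_diagonal L 3 α w (z0 w ∘ ⇑(ρ w))⟩ : archLocal L 3 (Matrix.diagonal α) w)} : Set _)))
      (Subgroup.centralizer ({archDiagTorus L 3 α fun w => z0 w ∘ ⇑(ρ w)} : Set _))
      (apply_mem_centralizer_iff_mem_pi_centralizer _ (archPiEquivCM 3 L (Matrix.diagonal α)).symm.toMulEquiv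
        (archPiEquivCM_symm_circleDiagonal_eq_archDiagTorus L 3 α fun w => z0 w ∘ ⇑(ρ w)))
      (archPiEquivCM 3 L (Matrix.diagonal α)).symm.continuous (archPiEquivCM 3 L (Matrix.diagonal α)).continuous))
    (hq : haveI : ∀ w : {w : InfinitePlace L // IsComplex w}, LocallyCompactSpace (archLocal L 3 (Matrix.diagonal α) w) := fun w => locallyCompactSpace_archLocal L 3 (Matrix.diagonal α) w
      haveI : ∀ w : {w : InfinitePlace L // IsComplex w}, SecondCountableTopology (archLocal L 3 (Matrix.diagonal α) w) := fun w => secondCountableTopology_archLocal L 3 (Matrix.diagonal α) w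
      m.atPoint (archDiagTorus L 3 α fun w => z0 w ∘ ⇑(ρ w)) =
        quotientMeasure (Subgroup.centralizer ({archDiagTorus L 3 α fun w => z0 w ∘ ⇑(ρ w)} : Set _)) ρ' (isClosed_coe_centralizer_singleton _)
          ((Measure.pi νw).map (archPiEquivCM 3 L (Matrix.diagonal α)).symm)) :
    haveI : ∀ (v : {w : InfinitePlace L // IsComplex w}) (τ : Perm (Fin 3)), LocallyCompactSpace (archLocal L 3 (Matrix.diagonal (α ∘ ⇑τ)) v) := fun v τ => locallyCompactSpace_archLocal L 3 (Matrix.diagonal (α ∘ ⇑τ)) v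
    haveI : ∀ (v : {w : InfinitePlace L // IsComplex w}) (τ : Perm (Fin 3)), SecondCountableTopology (archLocal L 3 (Matrix.diagonal (α ∘ ⇑τ)) v) := fun v τ => secondCountableTopology_archLocal L 3 (Matrix.diagonal (α ∘ ⇑τ)) v
    haveI : ∀ v : {w : InfinitePlace L // IsComplex w}, LocallyCompactSpace (archLocal L 3 (Matrix.diagonal α) v) := fun v => locallyCompactSpace_archLocal L 3 (Matrix.diagonal α) v
    haveI : ∀ v : {w : InfinitePlace L // IsComplex w}, SecondCountableTopology (archLocal L 3 (Matrix.diagonal α) v) := fun v => secondCountableTopology_archLocal L 3 (Matrix.diagonal α) v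
    haveI : ∀ (v : {w : InfinitePlace L // IsComplex w}) (τ : Perm (Fin 3)), (νH v τ).IsHaarMeasure := fun v τ => (hνH v τ).1
    haveI : ∀ (v : {w : InfinitePlace L // IsComplex w}) (τ : Perm (Fin 3)), (νH v τ).IsInvInvariant := fun v τ => (hνH v τ).2
    haveI : ∀ (v : {w : InfinitePlace L // IsComplex w}) (τ : Perm (Fin 3)), (ντ v τ).IsHaarMeasure := fun v τ => (hντi v τ).1
    haveI : ∀ (v : {w : InfinitePlace L // IsComplex w}) (τ : Perm (Fin 3)), (ντ v τ).IsMulRightInvariant := fun v τ => (hντi v τ).2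
    ∫ o, Θ ((((archPiEquivCM 3 L (Matrix.diagonal α)).symm o : arch (↥(maximalRealSubfield L)) L (IsCMField.complexConj L) 3 (Matrix.diagonal α)) : GL (Fin 3) (mixedSpace L)) : Matrix (Fin 3) (Fin 3) (mixedSpace L)) ∂(Measure.pi (fun v : {w : InfinitePlace L // IsComplex w} =>
              (if 0 < (v.1.embedding (α ((ρ v)⁻¹ 0))).re * (v.1.embedding (α ((ρ v)⁻¹ 2))).re then (νw v).map fun y : archLocal L 3 (Matrix.diagonal α) v => y * (⟨circleDiagonal 3 (z0 v ∘ ⇑(ρ v)), circleDiagonal_mem_archLocal_diagonal L 3 α v (z0 v ∘ ⇑(ρ v))⟩ : archLocal L 3 (Matrix.diagonal α) v) * y⁻¹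
              else ((quotientMeasure _ (νH v (ρ v)⁻¹) (isClosed_coe_centralizer_singleton _) (ντ v (ρ v)⁻¹)).map
                (descConj (⟨circleDiagonal 3 (z0 v), circleDiagonal_mem_archLocal_diagonal L 3 (α ∘ ⇑(ρ v)⁻¹) v (z0 v)⟩ : archLocal L 3 (Matrix.diagonal (α ∘ ⇑(ρ v)⁻¹)) v)
                  (Subgroup.centralizer ({(⟨circleDiagonal 3 (z₁ v), circleDiagonal_mem_archLocal_diagonal L 3 (α ∘ ⇑(ρ v)⁻¹) v (z₁ v)⟩ :
                    archLocal L 3 (Matrix.diagonal (α ∘ ⇑(ρ v)⁻¹)) v)} : Set (archLocal L 3 (Matrix.diagonal (α ∘ ⇑(ρ v)⁻¹)) v)))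
                  (forall_mem_centralizer_circleDiagonal_comm_of_wall L (α ∘ ⇑(ρ v)⁻¹) v (h02 v) (h01 v) (hwall v).1 (hwall v).2) id)).map
                (ContinuousMulEquiv.restrictSubgroup (GLn.conjEquiv (Matrix.GeneralLinearGroup.mkOfDetNeZero _ (det_monomial_one_ne_zero 3 (ρ v)⁻¹)))
              (archLocal L 3 (Matrix.diagonal (α ∘ ⇑(ρ v)⁻¹)) v) (archLocal L 3 (Matrix.diagonal α) v)
              (mem_archLocal_comp_perm_iff_conj_mem L 3 α v (ρ v)⁻¹))))) =
      ((∏ v : {w : InfinitePlace L // IsComplex w}, (if 0 < (v.1.embedding (α ((ρ v)⁻¹ 0))).re * (v.1.embedding (α ((ρ v)⁻¹ 2))).re then (ρZ v (ρ v) Set.univ).toNNReal else 1 : ℝ≥0) : ℝ≥0) : ℝ) •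
        classOrbitalIntegral m (fun x : arch (↥(maximalRealSubfield L)) L (IsCMField.complexConj L) 3 (Matrix.diagonal α) => Θ ((x : GL (Fin 3) (mixedSpace L)) : Matrix (Fin 3) (Fin 3) (mixedSpace L)))
          (ConjClasses.mk (archDiagTorus L 3 α fun w => z0 w ∘ ⇑(ρ w))) := by
  classical
  haveI hLC : ∀ (v : {w : InfinitePlace L // IsComplex w}) (τ : Perm (Fin 3)), LocallyCompactSpace (archLocal L 3 (Matrix.diagonal (α ∘ ⇑τ)) v) :=
    fun v τ => locallyCompactSpace_archLocal L 3 (Matrix.diagonal (α ∘ ⇑τ)) v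
  haveI hSC : ∀ (v : {w : InfinitePlace L // IsComplex w}) (τ : Perm (Fin 3)), SecondCountableTopology (archLocal L 3 (Matrix.diagonal (α ∘ ⇑τ)) v) :=
    fun v τ => secondCountableTopology_archLocal L 3 (Matrix.diagonal (α ∘ ⇑τ)) v
  haveI hLCv : ∀ v : {w : InfinitePlace L // IsComplex w}, LocallyCompactSpace (archLocal L 3 (Matrix.diagonal α) v) := fun v => locallyCompactSpace_archLocal L 3 (Matrix.diagonal α) v
  haveI hSCv : ∀ v : {w : InfinitePlace L // IsComplex w}, SecondCountableTopology (archLocal L 3 (Matrix.diagonal α) v) := fun v => secondCountableTopology_archLocal L 3 (Matrix.diagonal α) v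
  haveI hH1 : ∀ (v : {w : InfinitePlace L // IsComplex w}) (τ : Perm (Fin 3)), (νH v τ).IsHaarMeasure := fun v τ => (hνH v τ).1
  haveI hH2 : ∀ (v : {w : InfinitePlace L // IsComplex w}) (τ : Perm (Fin 3)), (νH v τ).IsInvInvariant := fun v τ => (hνH v τ).2
  haveI hT1 : ∀ (v : {w : InfinitePlace L // IsComplex w}) (τ : Perm (Fin 3)), (ντ v τ).IsHaarMeasure := fun v τ => (hντi v τ).1
  haveI hT2 : ∀ (v : {w : InfinitePlace L // IsComplex w}) (τ : Perm (Fin 3)), (ντ v τ).IsMulRightInvariant := fun v τ => (hντi v τ).2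
  have hreal : ∀ (v : {w : InfinitePlace L // IsComplex w}) (i : Fin 3), (v.1.embedding (α i)).im = 0 := fun v i => im_embedding_eq_zero_of_complexConj_eq L v (hherm i)
  -- each wall factor is `λ_v(ρ_v) •` the Weil-quotient orbit measure at `diag(z⁰_v ∘ ρ_v)` (★ p842112)
  have hfac : (fun v : {w : InfinitePlace L // IsComplex w} =>
              (if 0 < (v.1.embedding (α ((ρ v)⁻¹ 0))).re * (v.1.embedding (α ((ρ v)⁻¹ 2))).re then (νw v).map fun y : archLocal L 3 (Matrix.diagonal α) v => y * (⟨circleDiagonal 3 (z0 v ∘ ⇑(ρ v)), circleDiagonal_mem_archLocal_diagonal L 3 α v (z0 v ∘ ⇑(ρ v))⟩ : archLocal L 3 (Matrix.diagonal α) v) * y⁻¹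
              else ((quotientMeasure _ (νH v (ρ v)⁻¹) (isClosed_coe_centralizer_singleton _) (ντ v (ρ v)⁻¹)).map
                (descConj (⟨circleDiagonal 3 (z0 v), circleDiagonal_mem_archLocal_diagonal L 3 (α ∘ ⇑(ρ v)⁻¹) v (z0 v)⟩ : archLocal L 3 (Matrix.diagonal (α ∘ ⇑(ρ v)⁻¹)) v)
                  (Subgroup.centralizer ({(⟨circleDiagonal 3 (z₁ v), circleDiagonal_mem_archLocal_diagonal L 3 (α ∘ ⇑(ρ v)⁻¹) v (z₁ v)⟩ :
                    archLocal L 3 (Matrix.diagonal (α ∘ ⇑(ρ v)⁻¹)) v)} : Set (archLocal L 3 (Matrix.diagonal (α ∘ ⇑(ρ v)⁻¹)) v)))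
                  (forall_mem_centralizer_circleDiagonal_comm_of_wall L (α ∘ ⇑(ρ v)⁻¹) v (h02 v) (h01 v) (hwall v).1 (hwall v).2) id)).map
                (ContinuousMulEquiv.restrictSubgroup (GLn.conjEquiv (Matrix.GeneralLinearGroup.mkOfDetNeZero _ (det_monomial_one_ne_zero 3 (ρ v)⁻¹)))
              (archLocal L 3 (Matrix.diagonal (α ∘ ⇑(ρ v)⁻¹)) v) (archLocal L 3 (Matrix.diagonal α) v)
              (mem_archLocal_comp_perm_iff_conj_mem L 3 α v (ρ v)⁻¹)))) =
      fun v : {w : InfinitePlace L // IsComplex w} =>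
        haveI : (ρZ v (ρ v)).IsHaarMeasure := (hρZi v (ρ v)).1
        haveI : (ρZ v (ρ v)).IsInvInvariant := (hρZi v (ρ v)).2
        haveI : (νw v).IsHaarMeasure := (hνw v).1
        haveI : (νw v).IsMulRightInvariant := (hνw v).2
        ((if 0 < (v.1.embedding (α ((ρ v)⁻¹ 0))).re * (v.1.embedding (α ((ρ v)⁻¹ 2))).re then (ρZ v (ρ v) Set.univ).toNNReal else 1 : ℝ≥0)) •
          (quotientMeasure _ (ρZ v (ρ v)) (isClosed_coe_centralizer_singleton _) (νw v)).map
            (descConj (⟨circleDiagonal 3 (z0 v ∘ ⇑(ρ v)), circleDiagonal_mem_archLocal_diagonal L 3 α v (z0 v ∘ ⇑(ρ v))⟩ : archLocal L 3 (Matrix.diagonal α) v)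
              (Subgroup.centralizer _) (fun _ hg => Subgroup.mem_centralizer_singleton_iff.1 hg) id) := by
    funext v
    haveI : (ρZ v (ρ v)).IsHaarMeasure := (hρZi v (ρ v)).1
    haveI : (ρZ v (ρ v)).IsInvInvariant := (hρZi v (ρ v)).2
    haveI : (νw v).IsHaarMeasure := (hνw v).1
    haveI : (νw v).IsMulRightInvariant := (hνw v).2
    haveI : (νH v (ρ v)⁻¹).IsHaarMeasure := (hνH v (ρ v)⁻¹).1
    haveI : (νH v (ρ v)⁻¹).IsInvInvariant := (hνH v (ρ v)⁻¹).2
    haveI : (ντ v (ρ v)⁻¹).IsHaarMeasure := (hντi v (ρ v)⁻¹).1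
    haveI : (ντ v (ρ v)⁻¹).IsMulRightInvariant := (hντi v (ρ v)⁻¹).2
    exact wallFactor_eq_nnreal_smul_map_descConj_quotientMeasure L α v (νw v) (h02 v) (h01 v) (hwall v).1 (hwall v).2 hα (hreal v) (ρ v)
      (νH v (ρ v)⁻¹) (ντ v (ρ v)⁻¹) (by rw [hντ]) (ρZ v (ρ v)) (hρZ v (ρ v))
  rw [hfac]
  clear hfac hH1 hH2 hT1 hT2
  haveI hN1 : ∀ v : {w : InfinitePlace L // IsComplex w}, (νw v).IsHaarMeasure := fun v => (hνw v).1
  haveI hN2 : ∀ v : {w : InfinitePlace L // IsComplex w}, (νw v).IsMulRightInvariant := fun v => (hνw v).2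
  haveI hR1 : ∀ v : {w : InfinitePlace L // IsComplex w}, (ρZ v (ρ v)).IsHaarMeasure := fun v => (hρZi v (ρ v)).1
  haveI hR2 : ∀ v : {w : InfinitePlace L // IsComplex w}, (ρZ v (ρ v)).IsInvInvariant := fun v => (hρZi v (ρ v)).2
  -- σ-finiteness of the per-place Weil quotients and of their orbit measures (★ p842112 §3)
  have hrad := fun v : {w : InfinitePlace L // IsComplex w} =>
    isFiniteMeasureOnCompacts_and_sigmaFinite_map_descConj_quotientMeasure_wall L α v hα hherm (νw v) (ρ v) (hwall v).1 (hwall v).2 (ρZ v (ρ v))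
  haveI : ∀ v : {w : InfinitePlace L // IsComplex w}, SigmaFinite ((quotientMeasure _ (ρZ v (ρ v)) (isClosed_coe_centralizer_singleton _) (νw v)).map
            (descConj (⟨circleDiagonal 3 (z0 v ∘ ⇑(ρ v)), circleDiagonal_mem_archLocal_diagonal L 3 α v (z0 v ∘ ⇑(ρ v))⟩ : archLocal L 3 (Matrix.diagonal α) v)
              (Subgroup.centralizer _) (fun _ hg => Subgroup.mem_centralizer_singleton_iff.1 hg) id)) := fun v => (hrad v).2
  haveI : ∀ v : {w : InfinitePlace L // IsComplex w}, SigmaFinite (quotientMeasure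
      (Subgroup.centralizer ({(⟨circleDiagonal 3 (z0 v ∘ ⇑(ρ v)), circleDiagonal_mem_archLocal_diagonal L 3 α v (z0 v ∘ ⇑(ρ v))⟩ : archLocal L 3 (Matrix.diagonal α) v)} : Set _))
      (ρZ v (ρ v)) (isClosed_coe_centralizer_singleton _) (νw v)) := fun v => by
    haveI : IsLocallyFiniteMeasure (quotientMeasure
      (Subgroup.centralizer ({(⟨circleDiagonal 3 (z0 v ∘ ⇑(ρ v)), circleDiagonal_mem_archLocal_diagonal L 3 α v (z0 v ∘ ⇑(ρ v))⟩ : archLocal L 3 (Matrix.diagonal α) v)} : Set _))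
      (ρZ v (ρ v)) (isClosed_coe_centralizer_singleton _) (νw v)) := isLocallyFiniteMeasure_of_isFiniteMeasureOnCompacts
    exact sigmaFinite_of_locallyFinite
  have hΘm : Measurable fun x : arch (↥(maximalRealSubfield L)) L (IsCMField.complexConj L) 3 (Matrix.diagonal α) =>
      Θ ((x : GL (Fin 3) (mixedSpace L)) : Matrix (Fin 3) (Fin 3) (mixedSpace L)) :=
    (hΘ.comp (Units.continuous_val.comp continuous_subtype_val)).measurable
  exact integral_comp_archPiEquivCM_symm_pi_smul_map_descConj_eq_smul_classOrbitalIntegral L 3 α (fun w => z0 w ∘ ⇑(ρ w)) νw (fun w => ρZ w (ρ w)) ρP hρP m ρ' hρ' hq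
    (fun v => (if 0 < (v.1.embedding (α ((ρ v)⁻¹ 0))).re * (v.1.embedding (α ((ρ v)⁻¹ 2))).re then (ρZ v (ρ v) Set.univ).toNNReal else 1 : ℝ≥0)) _ hΘm

end Literature.NumberTheory.Rogawski1990

end
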